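import Literature.MathematicalPhysics.QuantumLattice.InfVolFermionStateTorusLimitTwoSectorCompanionChain
import Literature.MathematicalPhysics.QuantumLattice.InfVolFermionStateTorusLimitTwoSectorPairCompanionEnergyWindow
import HarnessLib

/-!
# The two-sector rows of the SPIN-FLIP template `c†_{x↑}c_{y↓}` for the thermal object of record: image sectors
# `(k_L + 1, k_L − 1)`, rows, rows between the companions, and hypothesis-free existence of the joint data

Topic `Literature/MathematicalPhysics/QuantumLattice`; complement of
`InfVolFermionStateTorusLimitTwoSectorPairAnnihilator.lean` (the pair template `c_{x↑}c_{y↓}`, charge `−2`,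
spin `0`) and of `…CompanionChain.lean` (the «add↑» companion `(k_L + 1, k_L)`). The spin-flip generator `S⁺_{xy} = c†_{x↑}c_{y↓}`
(charge `0`, spin `+1`; the rows that carry transverse spin correlations of a thermal relaxation) maps the
sector `(k, k)` of the thermal object of record into `(k + 1, k − 1)` — a fixed-MAGNETISATION sector `S^z = 1` —
and its adjoint maps back. As for every charged template, the row holds in TWO-STATE form with a companion
torus limit `ω'` of the canonical states of `(k_L + 1, k_L − 1)` and the limit `r` of
`Z_{(k+1,k−1)}/Z_{(k,k)}` (`= e^{−βh_can}`, the canonical cost of flipping a spin):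

* §1 sector lemmas (`spinFlip_mulVec_mem_szSector`, `…conjTranspose…`; the single steps `c_{y↓}`, `c†_{y↓}`
  between `(k + 1, k)` and `(k + 1, k − 1)`), the torus embedding of the local product, densities of the
  spin-flip companion (`n/2` both spins in the limit), nonemptiness;
* §2 `IsTorusLimitOfMixture.re_expect_twoSector_eeb_spinFlip_nonneg_of_sectorGibbs` — the spin-flip row for the
  object of record GIVEN joint data `(ω', r)`;
* §3 the «rm↓» rows BETWEEN the «add↑» companion `(k + 1, k)` and the spin-flip companion `(k + 1, k − 1)` and
  their reverse;
* §4 **existence, hypothesis-free** (`0 < n < 2`): by CHAINING `(k,k) → (k+1,k) → (k+1,k−1)`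
  (`…exists_twoSector_succCompanion_of_sectorGibbs`, then the abstract core with `c_{0↓}`: `x`-moment
  `Re ω⁺(n_{0↓}) = n/2`, `y'`-moment `1 − n/2` in every candidate): `∃ φ, ω⁺, ω^{sf}, r₁ > 0, r₂ > 0` with
  `Z⁺/Z → r₁`, `Z^{sf}/Z⁺ → r₂`, hence `Z^{sf}/Z → r₁r₂` — the joint data of §2 with `r = r₁r₂ > 0`.

* §5 entropy of the spin-flip sector and the companion's ENERGY-WINDOW rows in joint-data form
  (`…meanEnergy_spinFlipCompanion_le_of_tendsto`: `e_Φ(ω'') ≤ e_Φ(ω) + 2H_b(n/2)/β` and `≤ e(n) + 2H_b(n/2)/β`;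
  floor `e(n) ≤ e_Φ(ω'')`); its `D₄` thermal reader is the generic `…_of_spinSectorGibbs` one with the densities
  `…re_expect_nAt_eq_half_of_spinFlipCompanion`.

HONEST SCOPE: pairs of states along a common `Ls`; no `ω' = ω`; no number; the companion `(k + 1, k − 1)` has no
spin-flip symmetry. Everything is PROVED; no definition, no named fact.

## Mathlib / tree search

REUSED: `IsInSector.creation_up_mulVec`, `IsInSector.annihilation_down_mulVec`, `IsInSector.creation_down_mulVec`,
`IsInSector.annihilation_up_mulVec`, `mem_szSector_iff_isInSector` (`HubbardSzSectorLadder`);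
`InfVolFermionState.re_expect_twoSector_eeb_nonneg_of_canonical_limits_eventually`, `apply_eq_zero_off_of_mulVec_mem₂`;
`IsTorusLimitOfMixture.exists_twoSector_companion_of_pos_moments`, `…exists_twoSector_succCompanion_of_sectorGibbs`;
`…re_expect_nAt_eq_of_spinSectorGibbs`; pattern of
`…TwoSectorPairAnnihilator` / `…CompanionChain`. `lean search 'spinFlip_nonneg|spinFlip_mulVec_mem'`: nothing (2026-08-27).

## References

* H. Fawzi, O. Fawzi, S. O. Scalet (2024), Thm. 3.1. [cite: FawziFawziScalet2024, Thm. 3.1]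
* O. Bratteli, D. W. Robinson, *OAQSM 2* (1997), Thm. 5.3.15, §5.4.2. [cite: BratteliRobinsonII1997, §5.4.2]
* O. Bratteli, D. W. Robinson, *OAQSM 1* (1987), Thm. 2.3.15.
  [cite: BratteliRobinsonI1987, Thm. 2.3.15 (weak-⋆ compactness of the state space) and §4.3.1]
* E. H. Lieb, Phys. Rev. Lett. 62 (1989) 1201, eq. (2), proof of Thm. 1. [cite: LiebPRL1989, proof of Theorem 1]
* H. Araki, H. Moriya, Rev. Math. Phys. 15 (2003) 93, §4.1. [cite: ArakiMoriya2003, §4.1 Def. 4.3]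
-/

noncomputable section

namespace Literature.MathematicalPhysics.QuantumLattice

open Matrix Finset HubbardWave0 Literature.Probability.LatticeModels ThermodynamicLimit
open _root_.Filter
open scoped _root_.Topology ComplexOrder BigOperators

/-! ### §1 Sector lemmas, torus embedding, densities -/

section Sectors

variable (L : ℕ)

/-- The torus embedding of the local spin flip `c†_{x↑}c_{y↓} ∈ 𝔄_Λ` (through `𝔄_{Λ₁}`).
[cite: ArakiMoriya2003, §4.1 Def. 4.3] -/
theorem fermionEmbed_toTorusEmb_incl_spinFlip [NeZero L] {Λ : Finset (Site 2)}
    (h₁ : Set.InjOn (Torus.proj (d := 2) L) ↑(thicken Λ 1)) {x y : Site 2} (hx : x ∈ Λ) (hy : y ∈ Λ) :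
    fermionEmbed (PolySite.toTorusEmb L h₁)
        (fermionEmbed (PolySite.incl (subset_thicken Λ 1))
          (creation (orb (PolySite.pt x hx) 0) * annihilation (orb (PolySite.pt y hy) 1))) =
      creation (orb (PolySite.toTorusEmb L h₁ (PolySite.incl (subset_thicken Λ 1) (PolySite.pt x hx))) 0) *
        annihilation (orb (PolySite.toTorusEmb L h₁ (PolySite.incl (subset_thicken Λ 1) (PolySite.pt y hy))) 1) := by
  rw [fermionEmbed_mul, fermionEmbed_mul, fermionEmbed_creation, fermionEmbed_annihilation,
    fermionEmbed_creation, fermionEmbed_annihilation]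

/-- **`c†_{u↑}c_{v↓}` carries the sector `(rectN n L, S^z = 0) = (k, k)` into `(k + 1, k − 1)`** (`k ≥ 1`).
[cite: LiebPRL1989, proof of Theorem 1] -/
theorem spinFlip_mulVec_mem_szSector {n : ℝ} (hk : 1 ≤ halfRectN n L) (u v : FermionTorus 2 L)
    (w : Fock (Orb (FermionTorus 2 L))) (hw : w ∈ szSector (rectN n L) (0 : ℝ)) :
    (creation (orb u 0) * annihilation (orb v 1)) *ᵥ w ∈
      szSector ((halfRectN n L + 1) + (halfRectN n L - 1))
        ((((halfRectN n L + 1 : ℕ) : ℝ) - ((halfRectN n L - 1 : ℕ) : ℝ)) / 2) := by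
  rw [mem_szSector_iff_isInSector, ← mulVec_mulVec]
  have hw' : IsInSector (halfRectN n L) (halfRectN n L - 1 + 1) w := by
    rw [Nat.sub_add_cancel hk]
    exact (mem_szSector_rectN_iff n L w).1 hw
  exact (hw'.annihilation_down_mulVec v).creation_up_mulVec u

/-- **`(c†_{u↑}c_{v↓})ᴴ = c†_{v↓}c_{u↑}` carries `(k + 1, k − 1)` back into `(k, k)`** (`k ≥ 1`).
[cite: LiebPRL1989, proof of Theorem 1] -/
theorem spinFlip_conjTranspose_mulVec_mem_szSector_rectN {n : ℝ} (hk : 1 ≤ halfRectN n L)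
    (u v : FermionTorus 2 L) (w : Fock (Orb (FermionTorus 2 L)))
    (hw : w ∈ szSector ((halfRectN n L + 1) + (halfRectN n L - 1))
      ((((halfRectN n L + 1 : ℕ) : ℝ) - ((halfRectN n L - 1 : ℕ) : ℝ)) / 2)) :
    (creation (orb u 0) * annihilation (orb v 1))ᴴ *ᵥ w ∈ szSector (rectN n L) (0 : ℝ) := by
  rw [conjTranspose_mul, annihilation_conjTranspose, creation_conjTranspose, mem_szSector_rectN_iff,
    ← mulVec_mulVec]
  have hw' : IsInSector (halfRectN n L + 1) (halfRectN n L - 1) w := (mem_szSector_iff_isInSector _ _ w).1 hw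
  have h := (hw'.annihilation_up_mulVec u).creation_down_mulVec v
  rw [Nat.sub_add_cancel hk] at h
  exact h

/-- **`c_{v↓}` carries the «add↑» companion sector `(k + 1, k)` into the spin-flip sector `(k + 1, k − 1)`**
(`k ≥ 1`). [cite: LiebPRL1989, proof of Theorem 1] -/
theorem annihilation_down_mulVec_mem_szSector_spinFlip_of_succ {n : ℝ} (hk : 1 ≤ halfRectN n L)
    (v : FermionTorus 2 L) (w : Fock (Orb (FermionTorus 2 L)))
    (hw : w ∈ szSector ((halfRectN n L + 1) + halfRectN n L) ((((halfRectN n L + 1 : ℕ) : ℝ) - halfRectN n L) / 2)) :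
    annihilation (orb v 1) *ᵥ w ∈
      szSector ((halfRectN n L + 1) + (halfRectN n L - 1))
        ((((halfRectN n L + 1 : ℕ) : ℝ) - ((halfRectN n L - 1 : ℕ) : ℝ)) / 2) := by
  rw [mem_szSector_iff_isInSector]
  have hw' : IsInSector (halfRectN n L + 1) (halfRectN n L - 1 + 1) w := by
    rw [Nat.sub_add_cancel hk]
    exact (mem_szSector_iff_isInSector _ _ w).1 hw
  exact hw'.annihilation_down_mulVec v

/-- **`c†_{v↓}` carries the spin-flip sector `(k + 1, k − 1)` back into `(k + 1, k)`** (`k ≥ 1`).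
[cite: LiebPRL1989, proof of Theorem 1] -/
theorem creation_down_mulVec_mem_szSector_succ_of_spinFlip {n : ℝ} (hk : 1 ≤ halfRectN n L)
    (v : FermionTorus 2 L) (w : Fock (Orb (FermionTorus 2 L)))
    (hw : w ∈ szSector ((halfRectN n L + 1) + (halfRectN n L - 1))
        ((((halfRectN n L + 1 : ℕ) : ℝ) - ((halfRectN n L - 1 : ℕ) : ℝ)) / 2)) :
    (annihilation (orb v 1))ᴴ *ᵥ w ∈
      szSector ((halfRectN n L + 1) + halfRectN n L) ((((halfRectN n L + 1 : ℕ) : ℝ) - halfRectN n L) / 2) := by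
  rw [annihilation_conjTranspose, mem_szSector_iff_isInSector]
  have hw' : IsInSector (halfRectN n L + 1) (halfRectN n L - 1) w := (mem_szSector_iff_isInSector _ _ w).1 hw
  have h := hw'.creation_down_mulVec v
  rw [Nat.sub_add_cancel hk] at h
  exact h

namespace InfVolFermionState

/-- **Spin densities of the spin-flip companion `(k_L + 1, k_L − 1)`**: `Re ω'(n_{0↑}) = n/2` and
`Re ω'(n_{0↓}) = n/2` (`0 ≤ n < 2`; the magnetisation density of the `S^z = 1` sectors vanishes in the limit).
[cite: Ruelle1969, §3.4] [cite: LiebPRL1989, eq. (2)] -/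
theorem IsTorusLimitOfMixture.re_expect_nAt_eq_half_of_spinFlipCompanion (t t' U β : ℝ) {n : ℝ}
    (hn0 : 0 ≤ n) (hn2 : n < 2) {Ls : ℕ → ℕ} (hLs : Tendsto Ls atTop atTop) {ω' : InfVolFermionState 2}
    (hω' : ω'.IsTorusLimitOfMixture
      (fun L => Fintype.card (Subtype (spinConfig (Λ := FermionTorus 2 L) (halfRectN n L + 1) (halfRectN n L - 1))))
      (fun L i => canonicalWeight β (sectorEigenvalue (spinConfig (halfRectN n L + 1) (halfRectN n L - 1))
        (hubbardTorusTT' L t t' U) (hubbardTorusTT'_isHermitian L t t' U)) ((Fintype.equivFin _).symm i))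
      (fun L i => sectorEigenvector (spinConfig (halfRectN n L + 1) (halfRectN n L - 1)) (hubbardTorusTT' L t t' U)
        (hubbardTorusTT'_isHermitian L t t' U) ((Fintype.equivFin _).symm i)) Ls) :
    (ω'.expect {0} (nAt 0 (Finset.mem_singleton_self 0) 0)).re = n / 2 ∧
      (ω'.expect {0} (nAt 0 (Finset.mem_singleton_self 0) 1)).re = n / 2 := by
  have h := hω'.re_expect_nAt_eq_of_spinSectorGibbs t t' U β (fun L => halfRectN n L + 1) (fun L => halfRectN n L - 1)
    (fun _ => (Fintype.equivFin _).symm) (fun _ _ => rfl) (fun _ _ => rfl) hLs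
    ((eventually_halfRectN_succ_le_mul_self hn0 hn2 hLs).mono fun j hj =>
      ⟨hj, (Nat.sub_le _ _).trans (halfRectN_le_mul_self hn0 hn2.le (Ls j))⟩)
  exact ⟨h.1 (tendsto_halfRectN_succ_div_sq_comp hn0 hLs), h.2 (tendsto_halfRectN_pred_div_sq_comp hn0 hLs)⟩

end InfVolFermionState

end Sectors

/-! ### §2 The spin-flip row for the thermal object of record, given joint data -/

section Record

variable (t t' U β : ℝ)

/-- **The two-sector row of the spin flip `S⁺_{xy} = c†_{x↑}c_{y↓}` for the thermal object of record.** Let `ω`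
be a torus limit of the canonical Gibbs states of `hubbardTorusTT' (Ls j) t t' U` at inverse temperature `β` on
the sectors `(rectN n (Ls j), S^z = 0)` along `Ls → ∞` (`0 < n`), `ω'` a torus limit ALONG THE SAME `Ls` of the
canonical states of the spin-flip sectors `(k_L + 1, k_L − 1)`, and `r = lim_j Z_{(k+1,k−1)}(Ls j)/Z_{(k,k)}(Ls j)`.
Then for `x, y ∈ Λ`, `S̃ = Γ_{Λ⊆Λ₁}(c†_{x↑}c_{y↓})`, and all real `s, q` with `e^{s−1} ≤ q`:
`0 ≤ β·Re ω_{Λ₁}(S̃ᴴ(H_{Λ₁}S̃ − S̃H_{Λ₁})) − s·Re ω_{Λ₁}(S̃ᴴS̃) + q·r·Re ω'_{Λ₁}(S̃S̃ᴴ)` — the transverse-spin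
row of a thermal relaxation for the canonical object, sector mapping discharged.
[cite: FawziFawziScalet2024, Thm. 3.1] [cite: BratteliRobinsonII1997, §5.4.2] [cite: LiebPRL1989, proof of Theorem 1] -/
theorem InfVolFermionState.IsTorusLimitOfMixture.re_expect_twoSector_eeb_spinFlip_nonneg_of_sectorGibbs
    {n : ℝ} (hn : 0 < n) {Ls : ℕ → ℕ} (hLs : Tendsto Ls atTop atTop) {ω ω' : InfVolFermionState 2}
    (hω : ω.IsTorusLimitOfMixture (sectorGibbsCount n) (fun L => sectorGibbsWeightTT' β t t' U n L)
      (fun L => sectorGibbsVectorTT' t t' U n L) Ls)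
    (hω' : ω'.IsTorusLimitOfMixture
      (fun L => Fintype.card (Subtype (spinConfig (Λ := FermionTorus 2 L) (halfRectN n L + 1) (halfRectN n L - 1))))
      (fun L i => canonicalWeight β (sectorEigenvalue (spinConfig (halfRectN n L + 1) (halfRectN n L - 1))
        (hubbardTorusTT' L t t' U) (hubbardTorusTT'_isHermitian L t t' U)) ((Fintype.equivFin _).symm i))
      (fun L i => sectorEigenvector (spinConfig (halfRectN n L + 1) (halfRectN n L - 1)) (hubbardTorusTT' L t t' U)
        (hubbardTorusTT'_isHermitian L t t' U) ((Fintype.equivFin _).symm i)) Ls)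
    {r : ℝ} (hr : Tendsto (fun j =>
      (∑ d, Real.exp (-(β * sectorEigenvalue (spinConfig (halfRectN n (Ls j) + 1) (halfRectN n (Ls j) - 1))
          (hubbardTorusTT' (Ls j) t t' U) (hubbardTorusTT'_isHermitian (Ls j) t t' U) d))) /
        ∑ c, Real.exp (-(β * sectorEigenvalue (szConfig n (Ls j)) (hubbardTorusTT' (Ls j) t t' U)
          (hubbardTorusTT'_isHermitian (Ls j) t t' U) c))) atTop (𝓝 r))
    {Λ : Finset (Site 2)} {x y : Site 2} (hx : x ∈ Λ) (hy : y ∈ Λ) {s q : ℝ} (hq : Real.exp (s - 1) ≤ q) :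
    0 ≤ β * (ω.expect (thicken Λ 1)
          ((fermionEmbed (PolySite.incl (subset_thicken Λ 1))
              (creation (orb (PolySite.pt x hx) 0) * annihilation (orb (PolySite.pt y hy) 1)))ᴴ *
            ((hubbardTTPrimeFermionInteraction t t' U).localHamiltonian (thicken Λ 1) *
                fermionEmbed (PolySite.incl (subset_thicken Λ 1))
                  (creation (orb (PolySite.pt x hx) 0) * annihilation (orb (PolySite.pt y hy) 1)) -
              fermionEmbed (PolySite.incl (subset_thicken Λ 1))
                  (creation (orb (PolySite.pt x hx) 0) * annihilation (orb (PolySite.pt y hy) 1)) *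
                (hubbardTTPrimeFermionInteraction t t' U).localHamiltonian (thicken Λ 1)))).re -
        s * (ω.expect (thicken Λ 1)
          ((fermionEmbed (PolySite.incl (subset_thicken Λ 1))
              (creation (orb (PolySite.pt x hx) 0) * annihilation (orb (PolySite.pt y hy) 1)))ᴴ *
            fermionEmbed (PolySite.incl (subset_thicken Λ 1))
              (creation (orb (PolySite.pt x hx) 0) * annihilation (orb (PolySite.pt y hy) 1)))).re +
        q * r * (ω'.expect (thicken Λ 1)
          (fermionEmbed (PolySite.incl (subset_thicken Λ 1))
              (creation (orb (PolySite.pt x hx) 0) * annihilation (orb (PolySite.pt y hy) 1)) *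
            (fermionEmbed (PolySite.incl (subset_thicken Λ 1))
              (creation (orb (PolySite.pt x hx) 0) * annihilation (orb (PolySite.pt y hy) 1)))ᴴ)).re := by
  refine InfVolFermionState.re_expect_twoSector_eeb_nonneg_of_canonical_limits_eventually t t' U β
    (fun L => szConfig n L)
    (fun L => spinConfig (Λ := FermionTorus 2 L) (halfRectN n L + 1) (halfRectN n L - 1))
    (fun L s s' hs hs' => hubbardTorusTT'_apply_eq_zero_of_szConfig L t t' U n s s' hs hs')
    (fun L s s' hs hs' => hubbardTorusTT'_apply_eq_zero_of_spinConfig L t t' U _ _ s s' hs hs')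
    (fun L _ v s s' hs hs' => fockTranslate_apply_eq_zero_of_szConfig L v n s s' hs hs')
    (fun L _ v s s' hs hs' => fockTranslate_apply_eq_zero_of_spinConfig L v _ _ s s' hs hs')
    (fun L => sectorGibbsIndex n L) (fun L => (Fintype.equivFin _).symm)
    (sectorGibbsWeightTT'_eq_canonicalWeight t t' U β n) (fun L i => rfl) (fun L i => rfl) (fun L i => rfl)
    hLs hω hω' hr (creation (orb (PolySite.pt x hx) 0) * annihilation (orb (PolySite.pt y hy) 1)) ?_ ?_ hq
  · filter_upwards [eventually_one_le_halfRectN_comp hn hLs] with j hk hL h₁ s s' hs hs'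
    rw [fermionEmbed_toTorusEmb_incl_spinFlip]
    exact apply_eq_zero_off_of_mulVec_mem₂ (szConfig n (Ls j)) (spinConfig _ _)
      (szSector (rectN n (Ls j)) 0) (szSector _ _) (mem_szSector_rectN_iff n (Ls j))
      (mem_szSector_iff_spinConfig (Ls j) _ _)
      (fun w hw => spinFlip_mulVec_mem_szSector (Ls j) hk _ _ w hw) s s' hs hs'
  · filter_upwards [eventually_one_le_halfRectN_comp hn hLs] with j hk hL h₁ s s' hs hs'
    rw [fermionEmbed_toTorusEmb_incl_spinFlip]
    exact apply_eq_zero_off_of_mulVec_mem₂ (spinConfig _ _) (szConfig n (Ls j))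
      (szSector _ _) (szSector (rectN n (Ls j)) 0) (mem_szSector_iff_spinConfig (Ls j) _ _)
      (mem_szSector_rectN_iff n (Ls j))
      (fun w hw => spinFlip_conjTranspose_mulVec_mem_szSector_rectN (Ls j) hk _ _ w hw) s s' hs hs'

end Record

/-! ### §3 The «rm↓» rows BETWEEN the «add↑» companion `(k + 1, k)` and the spin-flip companion `(k + 1, k − 1)` -/

section Between

variable (t t' U β : ℝ)

/-- **The two-sector row linking the «add↑» companion to the spin-flip companion** (generator `c_{x↓}`,
`(k + 1, k) → (k + 1, k − 1)`; `0 < n`): for `ω⁺`, `ω''` torus limits along the same `Ls` of the canonical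
states of these sectors and `r₂ = lim Z_{(k+1,k−1)}/Z_{(k+1,k)}`:
`0 ≤ β·Re ω⁺_{Λ₁}(c̃†(H_{Λ₁}c̃ − c̃H_{Λ₁})) − s·Re ω⁺_{Λ₁}(c̃†c̃) + q·r₂·Re ω''_{Λ₁}(c̃c̃†)` (`c̃ = Γc_{x↓}`).
[cite: FawziFawziScalet2024, Thm. 3.1] [cite: BratteliRobinsonII1997, §5.4.2] [cite: LiebPRL1989, proof of Theorem 1] -/
theorem InfVolFermionState.IsTorusLimitOfMixture.re_expect_twoSector_eeb_annihilation_down_nonneg_of_succCompanion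
    {n : ℝ} (hn : 0 < n) {Ls : ℕ → ℕ} (hLs : Tendsto Ls atTop atTop) {ω' ω'' : InfVolFermionState 2}
    (hω' : ω'.IsTorusLimitOfMixture
      (fun L => Fintype.card (Subtype (spinConfig (Λ := FermionTorus 2 L) (halfRectN n L + 1) (halfRectN n L))))
      (fun L i => canonicalWeight β (sectorEigenvalue (spinConfig (halfRectN n L + 1) (halfRectN n L))
        (hubbardTorusTT' L t t' U) (hubbardTorusTT'_isHermitian L t t' U)) ((Fintype.equivFin _).symm i))
      (fun L i => sectorEigenvector (spinConfig (halfRectN n L + 1) (halfRectN n L)) (hubbardTorusTT' L t t' U)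
        (hubbardTorusTT'_isHermitian L t t' U) ((Fintype.equivFin _).symm i)) Ls)
    (hω'' : ω''.IsTorusLimitOfMixture
      (fun L => Fintype.card (Subtype (spinConfig (Λ := FermionTorus 2 L) (halfRectN n L + 1) (halfRectN n L - 1))))
      (fun L i => canonicalWeight β (sectorEigenvalue (spinConfig (halfRectN n L + 1) (halfRectN n L - 1))
        (hubbardTorusTT' L t t' U) (hubbardTorusTT'_isHermitian L t t' U)) ((Fintype.equivFin _).symm i))
      (fun L i => sectorEigenvector (spinConfig (halfRectN n L + 1) (halfRectN n L - 1)) (hubbardTorusTT' L t t' U)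
        (hubbardTorusTT'_isHermitian L t t' U) ((Fintype.equivFin _).symm i)) Ls)
    {r₂ : ℝ} (hr₂ : Tendsto (fun j =>
      (∑ d, Real.exp (-(β * sectorEigenvalue (spinConfig (halfRectN n (Ls j) + 1) (halfRectN n (Ls j) - 1))
            (hubbardTorusTT' (Ls j) t t' U) (hubbardTorusTT'_isHermitian (Ls j) t t' U) d))) /
        (∑ d, Real.exp (-(β * sectorEigenvalue (spinConfig (halfRectN n (Ls j) + 1) (halfRectN n (Ls j)))
            (hubbardTorusTT' (Ls j) t t' U) (hubbardTorusTT'_isHermitian (Ls j) t t' U) d)))) atTop (𝓝 r₂))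
    {Λ : Finset (Site 2)} {x : Site 2} (hx : x ∈ Λ) {s q : ℝ} (hq : Real.exp (s - 1) ≤ q) :
    0 ≤ β * (ω'.expect (thicken Λ 1)
          ((fermionEmbed (PolySite.incl (subset_thicken Λ 1)) (annihilation (orb (PolySite.pt x hx) 1)))ᴴ *
            ((hubbardTTPrimeFermionInteraction t t' U).localHamiltonian (thicken Λ 1) *
                fermionEmbed (PolySite.incl (subset_thicken Λ 1)) (annihilation (orb (PolySite.pt x hx) 1)) -
              fermionEmbed (PolySite.incl (subset_thicken Λ 1)) (annihilation (orb (PolySite.pt x hx) 1)) *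
                (hubbardTTPrimeFermionInteraction t t' U).localHamiltonian (thicken Λ 1)))).re -
        s * (ω'.expect (thicken Λ 1)
          ((fermionEmbed (PolySite.incl (subset_thicken Λ 1)) (annihilation (orb (PolySite.pt x hx) 1)))ᴴ *
            fermionEmbed (PolySite.incl (subset_thicken Λ 1)) (annihilation (orb (PolySite.pt x hx) 1)))).re +
        q * r₂ * (ω''.expect (thicken Λ 1)
          (fermionEmbed (PolySite.incl (subset_thicken Λ 1)) (annihilation (orb (PolySite.pt x hx) 1)) *
            (fermionEmbed (PolySite.incl (subset_thicken Λ 1)) (annihilation (orb (PolySite.pt x hx) 1)))ᴴ)).re := by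
  refine InfVolFermionState.re_expect_twoSector_eeb_nonneg_of_canonical_limits_eventually t t' U β
    (fun L => spinConfig (Λ := FermionTorus 2 L) (halfRectN n L + 1) (halfRectN n L))
    (fun L => spinConfig (Λ := FermionTorus 2 L) (halfRectN n L + 1) (halfRectN n L - 1))
    (fun L s s' hs hs' => hubbardTorusTT'_apply_eq_zero_of_spinConfig L t t' U _ _ s s' hs hs')
    (fun L s s' hs hs' => hubbardTorusTT'_apply_eq_zero_of_spinConfig L t t' U _ _ s s' hs hs')
    (fun L _ v s s' hs hs' => fockTranslate_apply_eq_zero_of_spinConfig L v _ _ s s' hs hs')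
    (fun L _ v s s' hs hs' => fockTranslate_apply_eq_zero_of_spinConfig L v _ _ s s' hs hs')
    (fun L => (Fintype.equivFin _).symm) (fun L => (Fintype.equivFin _).symm)
    (fun L i => rfl) (fun L i => rfl) (fun L i => rfl) (fun L i => rfl) hLs hω' hω'' hr₂
    (annihilation (orb (PolySite.pt x hx) 1)) ?_ ?_ hq
  · filter_upwards [eventually_one_le_halfRectN_comp hn hLs] with j hk hL h₁ s s' hs hs'
    rw [fermionEmbed_toTorusEmb_incl_annihilation]
    exact apply_eq_zero_off_of_mulVec_mem₂ (spinConfig _ _) (spinConfig _ _) (szSector _ _) (szSector _ _)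
      (mem_szSector_iff_spinConfig _ _ _) (mem_szSector_iff_spinConfig _ _ _)
      (fun w hw => annihilation_down_mulVec_mem_szSector_spinFlip_of_succ _ hk _ w hw) s s' hs hs'
  · filter_upwards [eventually_one_le_halfRectN_comp hn hLs] with j hk hL h₁ s s' hs hs'
    rw [fermionEmbed_toTorusEmb_incl_annihilation]
    exact apply_eq_zero_off_of_mulVec_mem₂ (spinConfig _ _) (spinConfig _ _) (szSector _ _) (szSector _ _)
      (mem_szSector_iff_spinConfig _ _ _) (mem_szSector_iff_spinConfig _ _ _)
      (fun w hw => creation_down_mulVec_mem_szSector_succ_of_spinFlip _ hk _ w hw) s s' hs hs'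

/-- **The reversed link**: `c†_{x↓}` from the spin-flip companion `(k + 1, k − 1)` back to `(k + 1, k)`, with the
INVERTED ratio `r₂' = lim Z_{(k+1,k)}/Z_{(k+1,k−1)}`. [cite: FawziFawziScalet2024, Thm. 3.1]
[cite: BratteliRobinsonII1997, §5.4.2] [cite: LiebPRL1989, proof of Theorem 1] -/
theorem InfVolFermionState.IsTorusLimitOfMixture.re_expect_twoSector_eeb_creation_down_reverse_nonneg_of_spinFlipCompanion
    {n : ℝ} (hn : 0 < n) {Ls : ℕ → ℕ} (hLs : Tendsto Ls atTop atTop) {ω' ω'' : InfVolFermionState 2}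
    (hω' : ω'.IsTorusLimitOfMixture
      (fun L => Fintype.card (Subtype (spinConfig (Λ := FermionTorus 2 L) (halfRectN n L + 1) (halfRectN n L))))
      (fun L i => canonicalWeight β (sectorEigenvalue (spinConfig (halfRectN n L + 1) (halfRectN n L))
        (hubbardTorusTT' L t t' U) (hubbardTorusTT'_isHermitian L t t' U)) ((Fintype.equivFin _).symm i))
      (fun L i => sectorEigenvector (spinConfig (halfRectN n L + 1) (halfRectN n L)) (hubbardTorusTT' L t t' U)
        (hubbardTorusTT'_isHermitian L t t' U) ((Fintype.equivFin _).symm i)) Ls)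
    (hω'' : ω''.IsTorusLimitOfMixture
      (fun L => Fintype.card (Subtype (spinConfig (Λ := FermionTorus 2 L) (halfRectN n L + 1) (halfRectN n L - 1))))
      (fun L i => canonicalWeight β (sectorEigenvalue (spinConfig (halfRectN n L + 1) (halfRectN n L - 1))
        (hubbardTorusTT' L t t' U) (hubbardTorusTT'_isHermitian L t t' U)) ((Fintype.equivFin _).symm i))
      (fun L i => sectorEigenvector (spinConfig (halfRectN n L + 1) (halfRectN n L - 1)) (hubbardTorusTT' L t t' U)
        (hubbardTorusTT'_isHermitian L t t' U) ((Fintype.equivFin _).symm i)) Ls)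
    {r₂' : ℝ} (hr₂' : Tendsto (fun j =>
      (∑ d, Real.exp (-(β * sectorEigenvalue (spinConfig (halfRectN n (Ls j) + 1) (halfRectN n (Ls j)))
            (hubbardTorusTT' (Ls j) t t' U) (hubbardTorusTT'_isHermitian (Ls j) t t' U) d))) /
        (∑ d, Real.exp (-(β * sectorEigenvalue (spinConfig (halfRectN n (Ls j) + 1) (halfRectN n (Ls j) - 1))
            (hubbardTorusTT' (Ls j) t t' U) (hubbardTorusTT'_isHermitian (Ls j) t t' U) d)))) atTop (𝓝 r₂'))
    {Λ : Finset (Site 2)} {x : Site 2} (hx : x ∈ Λ) {s q : ℝ} (hq : Real.exp (s - 1) ≤ q) :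
    0 ≤ β * (ω''.expect (thicken Λ 1)
          ((fermionEmbed (PolySite.incl (subset_thicken Λ 1)) (creation (orb (PolySite.pt x hx) 1)))ᴴ *
            ((hubbardTTPrimeFermionInteraction t t' U).localHamiltonian (thicken Λ 1) *
                fermionEmbed (PolySite.incl (subset_thicken Λ 1)) (creation (orb (PolySite.pt x hx) 1)) -
              fermionEmbed (PolySite.incl (subset_thicken Λ 1)) (creation (orb (PolySite.pt x hx) 1)) *
                (hubbardTTPrimeFermionInteraction t t' U).localHamiltonian (thicken Λ 1)))).re -
        s * (ω''.expect (thicken Λ 1)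
          ((fermionEmbed (PolySite.incl (subset_thicken Λ 1)) (creation (orb (PolySite.pt x hx) 1)))ᴴ *
            fermionEmbed (PolySite.incl (subset_thicken Λ 1)) (creation (orb (PolySite.pt x hx) 1)))).re +
        q * r₂' * (ω'.expect (thicken Λ 1)
          (fermionEmbed (PolySite.incl (subset_thicken Λ 1)) (creation (orb (PolySite.pt x hx) 1)) *
            (fermionEmbed (PolySite.incl (subset_thicken Λ 1)) (creation (orb (PolySite.pt x hx) 1)))ᴴ)).re := by
  refine InfVolFermionState.re_expect_twoSector_eeb_nonneg_of_canonical_limits_eventually t t' U β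
    (fun L => spinConfig (Λ := FermionTorus 2 L) (halfRectN n L + 1) (halfRectN n L - 1))
    (fun L => spinConfig (Λ := FermionTorus 2 L) (halfRectN n L + 1) (halfRectN n L))
    (fun L s s' hs hs' => hubbardTorusTT'_apply_eq_zero_of_spinConfig L t t' U _ _ s s' hs hs')
    (fun L s s' hs hs' => hubbardTorusTT'_apply_eq_zero_of_spinConfig L t t' U _ _ s s' hs hs')
    (fun L _ v s s' hs hs' => fockTranslate_apply_eq_zero_of_spinConfig L v _ _ s s' hs hs')
    (fun L _ v s s' hs hs' => fockTranslate_apply_eq_zero_of_spinConfig L v _ _ s s' hs hs')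
    (fun L => (Fintype.equivFin _).symm) (fun L => (Fintype.equivFin _).symm)
    (fun L i => rfl) (fun L i => rfl) (fun L i => rfl) (fun L i => rfl) hLs hω'' hω' hr₂'
    (creation (orb (PolySite.pt x hx) 1)) ?_ ?_ hq
  · filter_upwards [eventually_one_le_halfRectN_comp hn hLs] with j hk hL h₁ s s' hs hs'
    rw [fermionEmbed_toTorusEmb_incl_creation, ← annihilation_conjTranspose]
    exact apply_eq_zero_off_of_mulVec_mem₂ (spinConfig _ _) (spinConfig _ _) (szSector _ _) (szSector _ _)
      (mem_szSector_iff_spinConfig _ _ _) (mem_szSector_iff_spinConfig _ _ _)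
      (fun w hw => creation_down_mulVec_mem_szSector_succ_of_spinFlip _ hk _ w hw) s s' hs hs'
  · filter_upwards [eventually_one_le_halfRectN_comp hn hLs] with j hk hL h₁ s s' hs hs'
    rw [fermionEmbed_toTorusEmb_incl_creation, creation_conjTranspose]
    exact apply_eq_zero_off_of_mulVec_mem₂ (spinConfig _ _) (spinConfig _ _) (szSector _ _) (szSector _ _)
      (mem_szSector_iff_spinConfig _ _ _) (mem_szSector_iff_spinConfig _ _ _)
      (fun w hw => annihilation_down_mulVec_mem_szSector_spinFlip_of_succ _ hk _ w hw) s s' hs hs'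

end Between

/-! ### §4 The joint data of the spin-flip rows exist, hypothesis-free, by chaining `(k,k) → (k+1,k) → (k+1,k−1)` -/

section Existence

variable (t t' U β : ℝ)

/-- **The joint data of the «add↑», the «rm↓ from the add↑ companion» and the SPIN-FLIP rows exist
simultaneously, hypothesis-free.** For every torus limit `ω` of the canonical `(rectN n L, S^z = 0)` Gibbs
states along `Ls → ∞` (`0 < n < 2`) there are a strictly increasing `φ`, states `ω⁺` (torus limit along
`Ls ∘ φ` of the canonical states of `(k_L + 1, k_L)`) and `ω''` (the same for the spin-flip sectors
`(k_L + 1, k_L − 1)`) and reals `r₁, r₂ > 0` with `Z_{(k+1,k)}/Z_{(k,k)} → r₁`, `Z_{(k+1,k−1)}/Z_{(k+1,k)} → r₂`,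
hence `Z_{(k+1,k−1)}/Z_{(k,k)} → r₁r₂` along `Ls ∘ φ` — the joint data of
`…re_expect_twoSector_eeb_spinFlip_nonneg_of_sectorGibbs` with `r = r₁r₂ > 0`. (The spin-flip generator's own
`x`-moment `ω(n_{x↑}(1 − n_{y↓}))`-type correlation is not a density — the chain avoids it.)
[cite: BratteliRobinsonI1987, Thm. 2.3.15 (weak-⋆ compactness of the state space) and §4.3.1]
[cite: BratteliRobinsonII1997, §5.4.2] [cite: FawziFawziScalet2024, Thm. 3.1] -/
theorem InfVolFermionState.IsTorusLimitOfMixture.exists_twoSector_spinFlipCompanion_of_sectorGibbs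
    {n : ℝ} (hn0 : 0 < n) (hn2 : n < 2) {Ls : ℕ → ℕ} (hLs : Tendsto Ls atTop atTop)
    {ω : InfVolFermionState 2}
    (hω : ω.IsTorusLimitOfMixture (sectorGibbsCount n) (fun L => sectorGibbsWeightTT' β t t' U n L)
      (fun L => sectorGibbsVectorTT' t t' U n L) Ls) :
    ∃ φ : ℕ → ℕ, StrictMono φ ∧ ∃ ω' ω'' : InfVolFermionState 2, ∃ r₁ r₂ : ℝ, 0 < r₁ ∧ 0 < r₂ ∧
      ω.IsTorusLimitOfMixture (sectorGibbsCount n) (fun L => sectorGibbsWeightTT' β t t' U n L)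
        (fun L => sectorGibbsVectorTT' t t' U n L) (Ls ∘ φ) ∧
      ω'.IsTorusLimitOfMixture
        (fun L => Fintype.card (Subtype (spinConfig (Λ := FermionTorus 2 L) (halfRectN n L + 1) (halfRectN n L))))
      (fun L i => canonicalWeight β (sectorEigenvalue (spinConfig (halfRectN n L + 1) (halfRectN n L))
        (hubbardTorusTT' L t t' U) (hubbardTorusTT'_isHermitian L t t' U)) ((Fintype.equivFin _).symm i))
      (fun L i => sectorEigenvector (spinConfig (halfRectN n L + 1) (halfRectN n L)) (hubbardTorusTT' L t t' U)
        (hubbardTorusTT'_isHermitian L t t' U) ((Fintype.equivFin _).symm i)) (Ls ∘ φ) ∧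
      ω''.IsTorusLimitOfMixture
        (fun L => Fintype.card (Subtype (spinConfig (Λ := FermionTorus 2 L) (halfRectN n L + 1) (halfRectN n L - 1))))
      (fun L i => canonicalWeight β (sectorEigenvalue (spinConfig (halfRectN n L + 1) (halfRectN n L - 1))
        (hubbardTorusTT' L t t' U) (hubbardTorusTT'_isHermitian L t t' U)) ((Fintype.equivFin _).symm i))
      (fun L i => sectorEigenvector (spinConfig (halfRectN n L + 1) (halfRectN n L - 1)) (hubbardTorusTT' L t t' U)
        (hubbardTorusTT'_isHermitian L t t' U) ((Fintype.equivFin _).symm i)) (Ls ∘ φ) ∧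
      Tendsto (fun j => (∑ d, Real.exp (-(β * sectorEigenvalue (spinConfig (halfRectN n (Ls (φ j)) + 1) (halfRectN n (Ls (φ j))))
            (hubbardTorusTT' (Ls (φ j)) t t' U) (hubbardTorusTT'_isHermitian (Ls (φ j)) t t' U) d))) / (∑ c, Real.exp (-(β * sectorEigenvalue (szConfig n (Ls (φ j))) (hubbardTorusTT' (Ls (φ j)) t t' U)
            (hubbardTorusTT'_isHermitian (Ls (φ j)) t t' U) c)))) atTop (𝓝 r₁) ∧
      Tendsto (fun j => (∑ d, Real.exp (-(β * sectorEigenvalue (spinConfig (halfRectN n (Ls (φ j)) + 1) (halfRectN n (Ls (φ j)) - 1))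
            (hubbardTorusTT' (Ls (φ j)) t t' U) (hubbardTorusTT'_isHermitian (Ls (φ j)) t t' U) d))) / (∑ d, Real.exp (-(β * sectorEigenvalue (spinConfig (halfRectN n (Ls (φ j)) + 1) (halfRectN n (Ls (φ j))))
            (hubbardTorusTT' (Ls (φ j)) t t' U) (hubbardTorusTT'_isHermitian (Ls (φ j)) t t' U) d)))) atTop (𝓝 r₂) ∧
      Tendsto (fun j => (∑ d, Real.exp (-(β * sectorEigenvalue (spinConfig (halfRectN n (Ls (φ j)) + 1) (halfRectN n (Ls (φ j)) - 1))
            (hubbardTorusTT' (Ls (φ j)) t t' U) (hubbardTorusTT'_isHermitian (Ls (φ j)) t t' U) d))) / (∑ c, Real.exp (-(β * sectorEigenvalue (szConfig n (Ls (φ j))) (hubbardTorusTT' (Ls (φ j)) t t' U)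
            (hubbardTorusTT'_isHermitian (Ls (φ j)) t t' U) c)))) atTop (𝓝 (r₁ * r₂)) := by
  have hn0' : 0 ≤ n := hn0.le
  have hn2' : n ≤ 2 := hn2.le
  -- first step: the «add↑» companion
  obtain ⟨φ₁, hφ₁, ω', r₁, hr₁0, hω₁, hω', hr₁⟩ :=
    hω.exists_twoSector_succCompanion_of_sectorGibbs t t' U β hn0 hn2 hLs
  have hLs₁ : Tendsto (Ls ∘ φ₁) atTop atTop := hLs.comp hφ₁.tendsto_atTop
  -- second step: lower one ↓-electron from the «add↑» companion
  obtain ⟨φ₂, hφ₂, ω'', r₂, hr₂0, hω'₂, hω'', hr₂⟩ :=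
    hω'.exists_twoSector_companion_of_pos_moments t t' U β
      (fun L => spinConfig (Λ := FermionTorus 2 L) (halfRectN n L + 1) (halfRectN n L))
      (fun L => spinConfig (Λ := FermionTorus 2 L) (halfRectN n L + 1) (halfRectN n L - 1))
      (fun L s s' hs hs' => hubbardTorusTT'_apply_eq_zero_of_spinConfig L t t' U _ _ s s' hs hs')
      (fun L s s' hs hs' => hubbardTorusTT'_apply_eq_zero_of_spinConfig L t t' U _ _ s s' hs hs')
      (fun L _ v s s' hs hs' => fockTranslate_apply_eq_zero_of_spinConfig L v _ _ s s' hs hs')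
      (fun L _ v s s' hs hs' => fockTranslate_apply_eq_zero_of_spinConfig L v _ _ s s' hs hs')
      (fun L => (Fintype.equivFin _).symm) (fun L => (Fintype.equivFin _).symm)
      (fun L i => rfl) (fun L i => rfl) (fun L i => rfl) (fun L i => rfl) hLs₁
      ((eventually_halfRectN_succ_le_mul_self hn0' hn2 hLs₁).mono fun j hj => by
        obtain ⟨s, hs⟩ := exists_spinConfig_of_le (Ls (φ₁ j)) hj (halfRectN_le_mul_self hn0' hn2' _)
        exact ⟨⟨s, hs⟩⟩)
      ((eventually_halfRectN_succ_le_mul_self hn0' hn2 hLs₁).mono fun j hj => by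
        obtain ⟨s, hs⟩ := exists_spinConfig_of_le (Ls (φ₁ j)) hj
          ((Nat.sub_le _ _).trans (halfRectN_le_mul_self hn0' hn2' _))
        exact ⟨⟨s, hs⟩⟩)
      (Λ := {0}) (annihilation (orb (PolySite.pt (0 : Site 2) (Finset.mem_singleton_self 0)) 1))
      (by
        filter_upwards [eventually_one_le_halfRectN_comp hn0 hLs₁] with j hk hL h₁ s s' hs hs'
        rw [fermionEmbed_toTorusEmb_incl_annihilation]
        exact apply_eq_zero_off_of_mulVec_mem₂ (spinConfig _ _) (spinConfig _ _) (szSector _ _) (szSector _ _)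
          (mem_szSector_iff_spinConfig _ _ _) (mem_szSector_iff_spinConfig _ _ _)
          (fun w hw => annihilation_down_mulVec_mem_szSector_spinFlip_of_succ _ hk _ w hw) s s' hs hs')
      (by
        filter_upwards [eventually_one_le_halfRectN_comp hn0 hLs₁] with j hk hL h₁ s s' hs hs'
        rw [fermionEmbed_toTorusEmb_incl_annihilation]
        exact apply_eq_zero_off_of_mulVec_mem₂ (spinConfig _ _) (spinConfig _ _) (szSector _ _) (szSector _ _)
          (mem_szSector_iff_spinConfig _ _ _) (mem_szSector_iff_spinConfig _ _ _)
          (fun w hw => creation_down_mulVec_mem_szSector_succ_of_spinFlip _ hk _ w hw) s s' hs hs')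
      (by
        have hdown : (ω'.expect {0} (nAt 0 (Finset.mem_singleton_self 0) 1)).re = n / 2 :=
          (hω'.re_expect_nAt_eq_of_spinSectorGibbs t t' U β (fun L => halfRectN n L + 1) (fun L => halfRectN n L)
            (fun _ => (Fintype.equivFin _).symm) (fun _ _ => rfl) (fun _ _ => rfl) hLs₁
            ((eventually_halfRectN_succ_le_mul_self hn0' hn2 hLs₁).mono fun j hj =>
              ⟨hj, halfRectN_le_mul_self hn0' hn2' _⟩)).2 (tendsto_halfRectN_div_sq_comp hn0' hLs₁)
        rw [hω'.isTranslationInvariant.expect_conjTranspose_mul_fermionEmbed_incl_cAt, hdown]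
        exact half_pos hn0)
      (by
        intro φ ω'' hφ hω''
        rw [hω''.isTranslationInvariant.expect_fermionEmbed_incl_cAt_mul_conjTranspose, Complex.sub_re,
          Complex.one_re, (hω''.re_expect_nAt_eq_half_of_spinFlipCompanion t t' U β hn0' hn2 (hLs₁.comp hφ.tendsto_atTop)).2]
        linarith)
  -- assemble along `φ₁ ∘ φ₂`
  have hφ : StrictMono (fun j => φ₁ (φ₂ j)) := hφ₁.comp hφ₂
  have hLsφ : Tendsto (Ls ∘ fun j => φ₁ (φ₂ j)) atTop atTop := hLs.comp hφ.tendsto_atTop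
  have hr₁' := hr₁.comp hφ₂.tendsto_atTop
  refine ⟨fun j => φ₁ (φ₂ j), hφ, ω', ω'', r₁, r₂, hr₁0, hr₂0,
    hω₁.comp_tendsto hφ₂.tendsto_atTop, hω'₂, hω'', hr₁', hr₂, ?_⟩
  refine (hr₁'.mul hr₂).congr' ?_
  filter_upwards [eventually_halfRectN_succ_le_mul_self hn0' hn2 hLsφ] with j hk
  have hZ : (∑ c, Real.exp (-(β * sectorEigenvalue
      (spinConfig (halfRectN n (Ls (φ₁ (φ₂ j))) + 1) (halfRectN n (Ls (φ₁ (φ₂ j)))))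
      (hubbardTorusTT' (Ls (φ₁ (φ₂ j))) t t' U) (hubbardTorusTT'_isHermitian (Ls (φ₁ (φ₂ j))) t t' U) c))) ≠ 0 := by
    obtain ⟨s, hs⟩ := exists_spinConfig_of_le (Ls (φ₁ (φ₂ j))) hk (halfRectN_le_mul_self hn0' hn2' _)
    haveI : Nonempty (Subtype (spinConfig (Λ := FermionTorus 2 (Ls (φ₁ (φ₂ j))))
      (halfRectN n (Ls (φ₁ (φ₂ j))) + 1) (halfRectN n (Ls (φ₁ (φ₂ j)))))) := ⟨⟨s, hs⟩⟩
    exact (Finset.sum_pos (fun _ _ => Real.exp_pos _) Finset.univ_nonempty).ne'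
  have key : ∀ a b c : ℝ, b ≠ 0 → b / c * (a / b) = a / c := fun a b c hb => by
    rw [div_mul_div_comm, mul_comm b a, mul_div_mul_right _ _ hb]
  simp only [Function.comp_apply]
  exact key _ _ _ hZ

end Existence

/-! ### §5 Entropy and energy-window rows of the spin-flip companion (joint-data form) -/

section Windows

variable (t t' U β : ℝ)

/-- **Eventually `log #(k_L + 1, k_L − 1) ≤ s·L²` along `Ls → ∞` for every `s > 2H_b(n/2)`** (`0 ≤ n < 2`).
[cite: Israel1979, Lemma II.3.1] -/
theorem eventually_log_card_spinConfig_spinFlipCompanion_le {n : ℝ} (hn0 : 0 ≤ n) (hn2 : n < 2) {Ls : ℕ → ℕ}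
    (hLs : Tendsto Ls atTop atTop) {s : ℝ} (hs : 2 * Real.binEntropy (n / 2) < s) :
    ∀ᶠ j in atTop, Real.log (Fintype.card (Subtype (spinConfig (Λ := FermionTorus 2 (Ls j))
      (halfRectN n (Ls j) + 1) (halfRectN n (Ls j) - 1)))) ≤ s * (Ls j : ℝ) ^ 2 := by
  have hcont : Tendsto (fun j => Real.binEntropy (((halfRectN n (Ls j) + 1 : ℕ) : ℝ) / (Ls j : ℝ) ^ 2) +
      Real.binEntropy (((halfRectN n (Ls j) - 1 : ℕ) : ℝ) / (Ls j : ℝ) ^ 2)) atTop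
      (𝓝 (Real.binEntropy (n / 2) + Real.binEntropy (n / 2))) :=
    ((Real.binEntropy_continuous.tendsto _).comp (tendsto_halfRectN_succ_div_sq_comp hn0 hLs)).add
      ((Real.binEntropy_continuous.tendsto _).comp (tendsto_halfRectN_pred_div_sq_comp hn0 hLs))
  rw [← two_mul] at hcont
  filter_upwards [hcont.eventually (gt_mem_nhds hs), eventually_halfRectN_succ_le_mul_self hn0 hn2 hLs] with j hj hk
  have hL2 : (0 : ℝ) ≤ (Ls j : ℝ) ^ 2 := sq_nonneg _
  calc Real.log (Fintype.card (Subtype (spinConfig (Λ := FermionTorus 2 (Ls j))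
        (halfRectN n (Ls j) + 1) (halfRectN n (Ls j) - 1))))
      ≤ (Ls j : ℝ) ^ 2 * (Real.binEntropy (((halfRectN n (Ls j) + 1 : ℕ) : ℝ) / (Ls j : ℝ) ^ 2) +
          Real.binEntropy (((halfRectN n (Ls j) - 1 : ℕ) : ℝ) / (Ls j : ℝ) ^ 2)) :=
        log_card_subtype_spinConfig_le_binEntropy (Ls j) hk
          ((Nat.sub_le _ _).trans (halfRectN_le_mul_self hn0 hn2.le (Ls j)))
    _ ≤ (Ls j : ℝ) ^ 2 * s := mul_le_mul_of_nonneg_left hj.le hL2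
    _ = s * (Ls j : ℝ) ^ 2 := mul_comm _ _

/-- **Energy FLOOR for the spin-flip companion**: `e(t,t',U,n) ≤ e_Φ(ω'')` (`U ≥ 0`, `0 < n < 2`; translation
invariance and density `n/2 + n/2`). [cite: Ruelle1969, §3.4] -/
theorem InfVolFermionState.IsTorusLimitOfMixture.energyDensityTT'_le_meanEnergy_spinFlipCompanion
    (hU : 0 ≤ U) {n : ℝ} (hn0 : 0 < n) (hn2 : n < 2) {Ls : ℕ → ℕ} (hLs : Tendsto Ls atTop atTop)
    {ω'' : InfVolFermionState 2}
    (hω'' : ω''.IsTorusLimitOfMixture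
      (fun L => Fintype.card (Subtype (spinConfig (Λ := FermionTorus 2 L) (halfRectN n L + 1) (halfRectN n L - 1))))
      (fun L i => canonicalWeight β (sectorEigenvalue (spinConfig (halfRectN n L + 1) (halfRectN n L - 1))
        (hubbardTorusTT' L t t' U) (hubbardTorusTT'_isHermitian L t t' U)) ((Fintype.equivFin _).symm i))
      (fun L i => sectorEigenvector (spinConfig (halfRectN n L + 1) (halfRectN n L - 1)) (hubbardTorusTT' L t t' U)
        (hubbardTorusTT'_isHermitian L t t' U) ((Fintype.equivFin _).symm i)) Ls) :
    energyDensityTT' t t' U n ≤ ω''.meanEnergy (hubbardTTPrimeFermionInteraction t t' U) 1 := by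
  have hd := hω''.re_expect_nAt_eq_half_of_spinFlipCompanion t t' U β hn0.le hn2 hLs
  have hρ : ω''.density = n := by
    rw [InfVolFermionState.density, InfVolFermionState.densityAt, map_add, Complex.add_re, hd.1, hd.2]
    ring
  exact InfVolFermionState.energyDensityTT'_le_meanEnergy_of_isTranslationInvariant t t' hU hn0 hn2
    hω''.isTranslationInvariant hρ

/-- **Energy-window rows of the spin-flip companion, joint-data form** (`β > 0`, `U ≥ 0`, `0 < n < 2`): for the
thermal object of record `ω` and a spin-flip companion `ω''` along the same `Ls` with
`Z_{(k+1,k−1)}/Z_{(k,k)} → r > 0` (the data of `…exists_twoSector_spinFlipCompanion_of_sectorGibbs`, `r = r₁r₂`):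
`e_Φ(ω'') ≤ e_Φ(ω) + 2·H_b(n/2)/β` and `e_Φ(ω'') ≤ e(t,t',U,n) + 2·H_b(n/2)/β` — with the floor, the record N2′
window. [cite: Israel1979, Lemma II.3.1] [cite: Ruelle1969, §3.4] [cite: BratteliRobinsonII1997, §5.4.2] -/
theorem InfVolFermionState.IsTorusLimitOfMixture.meanEnergy_spinFlipCompanion_le_of_tendsto
    (hβ : 0 < β) (hU : 0 ≤ U) {n : ℝ} (hn0 : 0 < n) (hn2 : n < 2) {Ls : ℕ → ℕ}
    (hLs : Tendsto Ls atTop atTop) {ω ω'' : InfVolFermionState 2}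
    (hω : ω.IsTorusLimitOfMixture (sectorGibbsCount n) (fun L => sectorGibbsWeightTT' β t t' U n L)
      (fun L => sectorGibbsVectorTT' t t' U n L) Ls)
    (hω'' : ω''.IsTorusLimitOfMixture
      (fun L => Fintype.card (Subtype (spinConfig (Λ := FermionTorus 2 L) (halfRectN n L + 1) (halfRectN n L - 1))))
      (fun L i => canonicalWeight β (sectorEigenvalue (spinConfig (halfRectN n L + 1) (halfRectN n L - 1))
        (hubbardTorusTT' L t t' U) (hubbardTorusTT'_isHermitian L t t' U)) ((Fintype.equivFin _).symm i))
      (fun L i => sectorEigenvector (spinConfig (halfRectN n L + 1) (halfRectN n L - 1)) (hubbardTorusTT' L t t' U)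
        (hubbardTorusTT'_isHermitian L t t' U) ((Fintype.equivFin _).symm i)) Ls)
    {r : ℝ} (hr0 : 0 < r) (hr : Tendsto (fun j =>
      (∑ d, Real.exp (-(β * sectorEigenvalue (spinConfig (halfRectN n (Ls j) + 1) (halfRectN n (Ls j) - 1))
          (hubbardTorusTT' (Ls j) t t' U) (hubbardTorusTT'_isHermitian (Ls j) t t' U) d))) / (∑ c, Real.exp (-(β * sectorEigenvalue (szConfig n (Ls j)) (hubbardTorusTT' (Ls j) t t' U)
          (hubbardTorusTT'_isHermitian (Ls j) t t' U) c)))) atTop (𝓝 r)) :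
    ω''.meanEnergy (hubbardTTPrimeFermionInteraction t t' U) 1 ≤
        ω.meanEnergy (hubbardTTPrimeFermionInteraction t t' U) 1 + 2 * Real.binEntropy (n / 2) / β ∧
      ω''.meanEnergy (hubbardTTPrimeFermionInteraction t t' U) 1 ≤
        energyDensityTT' t t' U n + 2 * Real.binEntropy (n / 2) / β := by
  have hn0' : 0 ≤ n := hn0.le
  have hn2' : n ≤ 2 := hn2.le
  have hne' : ∀ᶠ j in atTop, Nonempty (Subtype (spinConfig (Λ := FermionTorus 2 (Ls j))
      (halfRectN n (Ls j) + 1) (halfRectN n (Ls j) - 1))) :=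
    (eventually_halfRectN_succ_le_mul_self hn0' hn2 hLs).mono fun j hj => by
      obtain ⟨s₁, hs₁⟩ := exists_spinConfig_of_le (Ls j) hj
        ((Nat.sub_le _ _).trans (halfRectN_le_mul_self hn0' hn2' _))
      exact ⟨⟨s₁, hs₁⟩⟩
  have hne : ∀ᶠ j in atTop, Nonempty (Subtype (szConfig n (Ls j))) :=
    Eventually.of_forall fun j => by
      obtain ⟨s₀, hs₀⟩ := exists_szConfig hn0' hn2' (Ls j)
      exact ⟨⟨s₀, hs₀⟩⟩
  constructor
  · refine le_of_forall_pos_le_add fun ε hε => ?_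
    have hs : 2 * Real.binEntropy (n / 2) < 2 * Real.binEntropy (n / 2) + β * ε := by
      linarith [mul_pos hβ hε]
    have hev := eventually_log_card_spinConfig_spinFlipCompanion_le hn0' hn2 hLs hs
    have hcap := InfVolFermionState.IsTorusLimitOfMixture.meanEnergy_le_meanEnergy_add_of_partitionRatio t t' U β hβ
      (fun L => szConfig n L) (fun L => spinConfig (Λ := FermionTorus 2 L) (halfRectN n L + 1) (halfRectN n L - 1))
      (fun L s s' hs hs' => hubbardTorusTT'_apply_eq_zero_of_szConfig L t t' U n s s' hs hs')
      (fun L s s' hs hs' => hubbardTorusTT'_apply_eq_zero_of_spinConfig L t t' U _ _ s s' hs hs')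
      (fun L => sectorGibbsIndex n L) (fun L => (Fintype.equivFin _).symm)
      (sectorGibbsWeightTT'_eq_canonicalWeight t t' U β n) (fun L i => rfl) (fun L i => rfl) (fun L i => rfl)
      hLs hω hω'' hne hne' hr0 hr hev
    have hsplit : (2 * Real.binEntropy (n / 2) + β * ε) / β = 2 * Real.binEntropy (n / 2) / β + ε := by
      rw [add_div, mul_div_assoc, mul_div_cancel_left₀ ε hβ.ne']
    linarith [hcap, hsplit]
  · refine le_of_forall_pos_le_add fun ε hε => ?_
    have hs : 2 * Real.binEntropy (n / 2) < 2 * Real.binEntropy (n / 2) + β * ε := by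
      linarith [mul_pos hβ hε]
    have hev := eventually_log_card_spinConfig_spinFlipCompanion_le hn0' hn2 hLs hs
    have hcap := InfVolFermionState.IsTorusLimitOfMixture.meanEnergy_companion_le_energyDensityTT'_add_of_partitionRatio
      t t' U β hβ hU hn0 hn2
      (fun L => spinConfig (Λ := FermionTorus 2 L) (halfRectN n L + 1) (halfRectN n L - 1))
      (fun L s s' hs hs' => hubbardTorusTT'_apply_eq_zero_of_spinConfig L t t' U _ _ s s' hs hs')
      (fun L => (Fintype.equivFin _).symm) (fun L i => rfl) (fun L i => rfl) hLs hω'' hne' hr0 hr hev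
    have hsplit : (2 * Real.binEntropy (n / 2) + β * ε) / β = 2 * Real.binEntropy (n / 2) / β + ε := by
      rw [add_div, mul_div_assoc, mul_div_cancel_left₀ ε hβ.ne']
    linarith [hcap, hsplit]

end Windows

end Literature.MathematicalPhysics.QuantumLattice

end
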